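import Literature.MathematicalPhysics.QuantumFieldTheory.Balaban1983to89.B8
import Literature.MathematicalPhysics.QuantumFieldTheory.Balaban1983to89.B8Lemma1Abelian

/-!
# `Balaban1983to89.B8Lemma1Lattice` — Lemma 1 of B8 (p. 79) on CONCRETE `ℤ^d` carriers in the abelian
# (additive) model: the leaf `B8.Lemma1Printed d (blockPair d L)` kernel-proved, hypothesis-free

CITATION HEADER (lean-in-tree rule 2026-08-18).  Kernel certificate for the combinatorial skeleton of the proof of
Lemma 1 of T. Bałaban, *Spaces of regular gauge field configurations on a lattice and gauge fixing conditions*, Comm.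
Math. Phys. **99**, 75–102 (1985) [Balaban1985RegularSpaces] (cell paper B8 of the audit cell `pub-balaban`;
`paper:balaban1985-cmp99-regular-spaces-gauge-fixing`, journal page = PDF page + 74), pp. 77, 79–80 [PDF 3, 5–6], with
the block / tree / averaging conventions it takes from [3] = T. Bałaban, *Averaging operations for lattice gauge
theories*, Comm. Math. Phys. **98**, 17–51 (1985) [Balaban1985Averaging] (cell paper B7; journal page = PDF page + 16),
pp. 19, 23–25 [PDF 3, 7–9].  Renders re-read AS IMAGES by the filing unit on 2026-08-19:
`…1985-cmp99-regular-spaces-gauge-fixing-p003-x4.png`, `-p005-x4.png`, `-p006-x4.png`; `…1985-cmp98-averaging-p003-x2.png`,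
`-p007-x2.png`, `-p008-x2.png`, `-p009-x2.png`.  The papers are manuscripts UNDER ADJUDICATION by the cell; nothing of
them is asserted here: the file DEFINES a concrete model of the objects of Lemma 1 and PROVES the printed conclusion
for it; no printed claim enters as a hypothesis.

PRINTED (B8 p. 79): "**Lemma 1.** Let V₀, V′V₀ satisfy the condition (1.7) for k = 1 and L arbitrary, and let
(R(V₀)V′)(Γ_{y,x}) = 1 for x ∈ B(y), |\overline{V′V₀} − V̄₀| < α₁ on Ω₁^{(1)}. (1.24)
Then for α₀, α₁ small the configuration V′ is also small, more precisely we have the bound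
|V′ − 1| < 4d²α₀ + α₁ on Ω₁. (1.25)
We will prove the lemma. From (1.22) and the assumptions we have
|(∂_{V₀}V′)(p) − 1| ≦ |V₀(∂p) − 1| + |(V′V₀)(∂p) − 1| < 2α₀L⁻². (1.26)
The conditions (R₀V′)(Γ_{y,x}) = 1, x ∈ B(y), imply V′_b = 1 for b ⊂ Γ_{y,x}. This and the above estimate imply
|V′_b − 1| < (d−1)(L−1)2α₀L⁻² for b ⊂ B(y) by the same reasoning as in [3] (between (44) and (46)). For a plaquette p
connecting two neighboring blocks B(c₋), B(c₊) we take two bonds b′, b″ ⊂ ∂p, b′, b″ ∈ B(c) and from (1.26) and the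
bounds on |V′_b − 1| for b′, b″ belonging either to B(c₋), or to B(c₊), we get |R(V₀(b′₋, b″₋))V′_{b″} − V′_{b′}| <
2α₀L⁻² + 4(d−1)α₀L⁻¹ < 4dα₀L⁻¹. Thus |R(V₀(Γ_{b₀,₋,b₋}))V′_b − V′_{b₀}| < (d−1)(L−1)4dα₀L⁻¹ < 4(d−1)dα₀ for an
arbitrary bond b ∈ B(c) and b₀ being the unique bond of c belonging to B(c). The condition |\overline{V′V₀} − V̄₀| =
|Ṽ′ − 1| < α₁ implies |R(V₀([c₋, b₀,₋]))V′_{b₀} − 1| ≦ 4(d−1)" (p. 80) "(L−1)Lα₀L⁻² + α₁ < 4(d−1)α₀ + α₁, hence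
finally we have the bound (1.25) for an arbitrary bond b.  From this proof it follows that the result is local in the
sense that the bound (1.25) for a bond b depends on bounds (1.7), (1.24) on B(c₋)∪B(c₊), if b belongs to this set."
PRINTED (B8 p. 79): "B^j(c) = {b ⊂ T : b₋ ∈ B^j(c₋), b₊ ∈ B^j(c₊)}. (1.23)";  "Ũ′^n = (\overline{U′U₀})^n(Ū₀^n)⁻¹. (1.20)";
"(∂_{U₀}U′)(p) = U′(x,y)R(U₀(x,y))U′(y,z)R(U₀(x,w))U′(z,w)U′(w,x). (1.22)".
PRINTED (B8 p. 77): "|U(∂p) − 1| < α₀L^{−2j} for p ∈ Ω_j, j = 0, 1, …, k, (1.7)".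
PRINTED ([3] p. 19): "Γ_{c,x} = Γ_{c₋,x} ∪ [x, x(c)] ∪ Γ_{x(c),c₊}", `x(c) = x + Le_μ` for `c = ⟨c₋, c₋ + Le_μ⟩`, `x ∈ B(c₋)`;
([3] p. 23) "Ū_c = exp[i Σ_{x∈B(c₋)} L^{−d} (1/i) log U(Γ_{c,x})U(c)⁻¹] U(c) (42)" (the average (15)/(42) is over the
`L^d` contours `Γ_{c,x}`, `x ∈ B(c₋)`); ([3] p. 24) the trees "Γ_{y,x} = [y, (y₁, …, y_{d−1}, x_d)] ∪ … ∪
[(y₁, x₂, …, x_d), x]" for `x` in a block with corner `y`, and "V₀(Γ_{y,x}) = 1 imply V₀(x, x+e₁) = 1, |V₀(x, x+e_μ) − 1| <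
(|x₁ − y₁| + … + |x_{μ−1} − y_{μ−1}|)α₀".

READING — THE ABELIAN (ADDITIVE) MODEL (the cell's model, as in `B8Lemma1Abelian`; not the paper's words).  Bond
variables `V_b ∈ G` ↦ real numbers `θ_b` (`θ x ν` on `b = ⟨x, x + e_ν⟩`, `−θ_b` on the reversed bond); products along
paths ↦ sums; `V(∂p)` and the covariant plaquette `(∂_{V₀}V′)(p)` of (1.22) ↦ the circulation `plaq θ x ρ ν`
(`R(·) ↦ id`); `|V − 1|` ↦ `|θ|`; the averages (15)/(42) of [3] ↦ arithmetic means over `x ∈ B(c₋)` of the contour sums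
`θ(Γ_{c,x})`; `V′V₀ ↦ θ₀ + θ′`, so that (1.20) `Ṽ′ = (\overline{V′V₀})(V̄₀)⁻¹ ↦ avg(θ₀ + θ′) − avg θ₀ = avg θ′`
(`avg_add_sub`).  Blocks are the corner-anchored `B(y) = y + {0, …, L−1}^d` of [3] p. 24 (`InBlock`), the axial trees
are the staircases `Γ_{y,x}` of [3] p. 24, coordinate `d` first (`mixK`/`treeSum`), the coarse bond `c = ⟨y, y + Le_μ⟩`
has `B(c₋) = B(y)`, `B(c₊) = B(y) + Le_μ` (`yplus`), and `B(c)` of (1.23) = the `L^{d−1}` crossing bonds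
`⟨x, x + e_μ⟩`, `x ∈ B(y)`, `x_μ = y_μ + L − 1` (`Trans`, `crossVal`).  READING of the index: by the locality remark
(p. 80 l. 2–4) the lemma is a family of statements, one per coarse bond `c`, with data and conclusion on
`B(c₋) ∪ B(c₊)`; the index type is `Site d × Fin d` (every corner `y ∈ ℤ^d` and direction `μ` — a superset of the
bonds of `Ω₁^{(1)}`, which only strengthens `∀ i`), `pertDev` is the `sup` of `|θ′_b|` over the bonds `b` with both
ends in `B(c₋) ∪ B(c₊)` (`regionBonds`; the union over `c` of these sets is the set of bonds of `Ω₁`).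

WHAT THE TREE ALREADY HAS.  `B8` (reader r1 / sub-cell B08): the abstract carrier `B8.LocalData` (`Cfg`, `Pert`,
`small`, `axialClose`, `pertDev`) and the leaf `B8.Lemma1Printed d fam` (= `DagBinding.B8LeafR.l1`), so far only ever a
HYPOTHESIS.  `B8Lemma1Abelian` (adv1-g9): the abelian averaging step with the GEOMETRY AS HYPOTHESES —
`lemma1_abelian` takes the number of steps `hN` (`Reach adj`, `≤ N = (d−1)(L−1)`), the step size `hs` (`≤ s = P + 2I`),
the `L − 1` interior bonds per contour `he` (`≤ (L−1)I`) and the mean `hmean` as binders and returns `|a t| < 4d²α₀ + α₁`;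
plus the coefficient analysis (`coeff_lt_printed`: the mean-based count stays below the printed `4d²`;
`printedChain_gt`: the chain completed literally at `b₀` exceeds it for `d ≥ 2` — census G-B8-10, not re-litigated here).

WHAT THIS FILE ADDS (kernel-checked; new sibling module, nothing above is edited).
§1 `ℤ^d` geometry: sites, unit vectors, offsets from a corner, plaquette circulations, the staircase tree `treeSum θ z k
   = θ(Γ_{z, z+k})` and its plaquette LADDER, and the discrete Stokes identity `stokes_tree`:
   `θ(Γ_{z,x+e_ν}) − θ(Γ_{z,x}) = θ⟨x, x+e_ν⟩ − Σ_{ladder} plaq` — the content of "the same reasoning as in [3] (between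
   (44) and (46))" (one plaquette per tree bond of a stage `ρ < ν`; `Σ_{ρ<ν} k_ρ ≤ (d−1)(L−1)` plaquettes).
§2 The axial gauge `TreeGauge` ((1.24), first half) and the printed consequences: tree bonds vanish
   (`treeBond_eq_zero` = "V′_b = 1 for b ⊂ Γ_{y,x}", in particular every `e₁`-bond, [3] p. 24), interior bonds equal
   their ladder (`bond_eq_ladder`) and `|θ′_b| ≤ (d−1)(L−1)·Pb` under a plaquette bound `Pb` (`interior_bound` =
   "|V′_b − 1| < (d−1)(L−1)2α₀L⁻² for b ⊂ B(y)").
§3 The two-block setting of a coarse bond: contour sums (42) (`contourSum` = tree + segment − tree), the block mean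
   `avg`, its linearity (`avg_add_sub` = (1.20)), the split of each segment `[x, x(c)]` into ONE crossing bond and `L − 1`
   interior bonds of `B(c₋)` or `B(c₊)` (`segment_split`, `abs_interiorPart_le`: `≤ (L−1)·I`), the neighbouring-crossing-
   bond step through one mixed plaquette and two interior bonds (`crossVal_step`: `≤ Pb + 2I` = "< 2α₀L⁻² +
   4(d−1)α₀L⁻¹"), and the chain of `≤ (d−1)(L−1)` transverse unit steps between any two crossing bonds (`reach_of_dist1`,
   `dist1_le` = "(d−1)(L−1)" steps "for an arbitrary bond b ∈ B(c)").
§4 `Small` = (1.7) for `k = 1` (`|plaq| < α₀L⁻²`) for BOTH `θ₀` and `θ₀ + θ′` on the plaquettes of `B(c₋) ∪ B(c₊)`;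
   `AxialClose` = (1.24); `pertDev`; **`lemma1_lattice`**: every bond of `B(c₋) ∪ B(c₊)` has `|θ′_b| < 4d²α₀ + α₁` —
   interior/tree bonds by §2 ((1.26): `Pb = P = 2α₀L⁻²` from the two (1.7)-bounds, `plaq_add`), crossing bonds by
   `B8Lemma1Abelian.lemma1_abelian` with ALL FOUR geometric binders discharged by §3; the carriers
   **`blockPair d L : Site d × Fin d → B8.LocalData`** and **`lemma1Printed_blockPair (d L : ℕ) :
   B8.Lemma1Printed d (blockPair d L)`** — hypothesis-free (`L = 0`: empty region; `d = 0`: no index; the constant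
   `c(α₀, α₁)` of "for α₀, α₁ small" is not needed in the abelian model, nominally `c = 1`).

HONEST SCOPE / NOT TYPED.  (i) ABELIAN MODEL ONLY: the non-abelian remainders of the real `G`-valued statement — the
`R(·)`-transports in (1.22)/(1.26) and in the crossing-bond chain, the BCH corrections behind (15) = (42) and (31)/(38)
of [3], the difference between `|V − 1|` and `|(1/i) log V|` — are NOT formalised; what is certified is that the
printed COUNT (which bonds, how many plaquettes, how many steps, which mean) yields the printed constant `4d²α₀ + α₁`
once those remainders are ignored (with the mean-based reading of the last step, `B8Lemma1Abelian.coeff_lt_printed`).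
(ii) The plaquette hypotheses are asked only for plaquettes with all four corners in `B(c₋) ∪ B(c₊)` (weaker than (1.7)
on `Ω₁`, so the typed lemma is formally stronger), and only the `j = 1` clause of (1.7) is used (as in (1.26)).
(iii) Corner-anchored blocks and `d`-first staircase trees are the [3] p. 24 convention as read by the cell; another
corner/ordering convention is a relabelling of coordinates.  (iv) `B(c₊) = B(c₋) + Le_μ` for a positively oriented
coarse bond; negatively oriented bonds are the same configuration read from the other block.  (v) Nothing here bears
on Theorem 2 / (1.65) beyond supplying the leaf `l1` on one concrete family; the DAG binder `DagBinding.B8LeafR` is NOT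
instantiated here (its other fields concern Thm 2 – Thm 8 carriers).  Value = kernel certificate of a printed lemma's
combinatorial skeleton on concrete carriers + one DAG leaf discharged by name for a concrete family, NOT summit
progress.  Unit `b2b-balaban-b08` gen 12 (journal claim LEMMA1-LATTICE-KERNEL; census C-B8-33, DIVERGENCE D-b08-g12.1).
-/

namespace Literature.MathematicalPhysics.QuantumFieldTheory.Balaban1983to89.B8Lemma1Lattice

open Finset

variable {d : ℕ}

/-! ### §1 `ℤ^d` geometry: sites, offsets, plaquettes, staircase trees and the discrete Stokes identity -/

/-- [folklore] Sites of the unit lattice ℤ^d. -/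
abbrev Site (d : ℕ) : Type := Fin d → ℤ

/-- [folklore] Additive (abelian-model) bond configurations: `θ x ν` = the Lie-algebra value on the bond
⟨x, x + e_ν⟩; values add along paths (the model of `B8Lemma1Abelian`). -/
abbrev Config (d : ℕ) : Type := Site d → Fin d → ℝ

/-- [folklore] The unit vector `e_ν`. -/
def e (ν : Fin d) : Site d := Pi.single ν 1

/-- [folklore] The site at offset `k ∈ ℕ^d` from the corner `z`. -/
def site (z : Site d) (k : Fin d → ℕ) : Site d := fun κ => z κ + (k κ : ℤ)

/-- [folklore] One unit step of the offset is one unit step of the site. -/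
theorem site_add_single (z : Site d) (k : Fin d → ℕ) (ν : Fin d) :
    site z (k + Pi.single ν 1) = site z k + e ν := by
  funext κ
  by_cases h : κ = ν
  · subst h; simp [site, e, add_assoc]
  · simp [site, e, h]

/-- [folklore] Offsets compose additively. -/
theorem site_site (z : Site d) (p q : Fin d → ℕ) : site (site z p) q = site z (p + q) := by
  funext κ; simp [site]; ring

/-- [folklore] Plaquette circulation `(∂θ)(p)` of the plaquette `p = (x; ρ, ν)`:
`θ⟨x,x+e_ρ⟩ + θ⟨x+e_ρ,x+e_ρ+e_ν⟩ − θ⟨x+e_ν,x+e_ν+e_ρ⟩ − θ⟨x,x+e_ν⟩`. -/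
def plaq (θ : Config d) (x : Site d) (ρ ν : Fin d) : ℝ :=
  θ x ρ + θ (x + e ρ) ν - θ (x + e ν) ρ - θ x ν

/-- [folklore] The plaquette circulation is additive in the configuration (abelian model). -/
theorem plaq_add (θ₀ θ' : Config d) (x : Site d) (ρ ν : Fin d) :
    plaq (θ₀ + θ') x ρ ν = plaq θ₀ x ρ ν + plaq θ' x ρ ν := by
  simp only [plaq, Pi.add_apply]; ring

/-- [cite: Balaban1985Averaging, p.24 trees Γ_{y,x}] Offsets of the `j`-th site of stage `ρ` of the staircase
tree `Γ_{z,x}`, `x = site z k`: coordinates `< ρ` still at the corner, coordinate `ρ` equal to `j`,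
coordinates `> ρ` already at `x` (p. 24: `Γ_{y,x} = [y,(y₁,…,y_{d−1},x_d)] ∪ … ∪ [(y₁,x₂,…,x_d),x]`,
coordinate `d` first). -/
def mixK (k : Fin d → ℕ) (ρ : Fin d) (j : ℕ) : Fin d → ℕ :=
  fun κ => if (κ : ℕ) < ρ then 0 else if κ = ρ then j else k κ

/-- [folklore] Offsets with the coordinates of index `< m` reset to the corner. -/
def trunc (k : Fin d → ℕ) (m : ℕ) : Fin d → ℕ := fun κ => if (κ : ℕ) < m then 0 else k κ

/-- [cite: Balaban1985Averaging, p.24 trees Γ_{y,x}] The additive holonomy `θ(Γ_{z,x})` of the staircase tree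
from the corner `z` to `x = site z k`: stage `ρ` runs the bonds `⟨site z (mixK k ρ j), · + e_ρ⟩`, `j < k ρ`. -/
def treeSum (θ : Config d) (z : Site d) (k : Fin d → ℕ) : ℝ :=
  ∑ ρ, ∑ j ∈ range (k ρ), θ (site z (mixK k ρ j)) ρ

/-- [cite: Balaban1985RegularSpaces, Lemma 1 proof p.79 "same reasoning as in [3] (between (44) and (46))"]
The ladder of plaquettes spanned by `Γ_{z,x} ∪ ⟨x, x+e_ν⟩` and `Γ_{z,x+e_ν}`: one plaquette `(site z (mixK k ρ j); ρ, ν)`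
for every tree bond of a stage `ρ < ν`, i.e. `Σ_{ρ<ν} k ρ ≤ (d−1)(L−1)` plaquettes. -/
def ladder (θ : Config d) (z : Site d) (k : Fin d → ℕ) (ν : Fin d) : ℝ :=
  ∑ ρ ∈ univ.filter (fun ρ : Fin d => (ρ : ℕ) < ν), ∑ j ∈ range (k ρ), plaq θ (site z (mixK k ρ j)) ρ ν

/-- [folklore] Raising coordinate `ν` of the endpoint does not move the stages `ρ > ν` of the tree. -/
theorem mixK_succ_of_lt {k : Fin d → ℕ} {ρ ν : Fin d} (h : (ν : ℕ) < ρ) (j : ℕ) :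
    mixK (k + Pi.single ν 1) ρ j = mixK k ρ j := by
  funext κ
  simp only [mixK, Pi.add_apply]
  by_cases h1 : (κ : ℕ) < ρ
  · simp [h1]
  · by_cases h2 : κ = ρ
    · simp [h2]
    · have hκν : κ ≠ ν := by rintro rfl; exact h1 h
      simp [h1, h2, hκν]

/-- [folklore] Raising coordinate `ν` of the endpoint does not move the sites of stage `ν` (it adds one). -/
theorem mixK_succ_self (k : Fin d → ℕ) (ν : Fin d) (j : ℕ) :
    mixK (k + Pi.single ν 1) ν j = mixK k ν j := by
  funext κ
  simp only [mixK, Pi.add_apply]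
  by_cases h1 : (κ : ℕ) < ν
  · simp [h1]
  · by_cases h2 : κ = ν
    · simp [h2]
    · simp [h1, h2]

/-- [folklore] Raising coordinate `ν` of the endpoint translates the stages `ρ < ν` by `e_ν`. -/
theorem mixK_succ_of_gt {k : Fin d → ℕ} {ρ ν : Fin d} (h : (ρ : ℕ) < ν) (j : ℕ) :
    mixK (k + Pi.single ν 1) ρ j = mixK k ρ j + Pi.single ν 1 := by
  funext κ
  simp only [mixK, Pi.add_apply]
  by_cases hκ : κ = ν
  · subst hκ
    have h1 : ¬ (κ : ℕ) < ρ := by omega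
    have h2 : κ ≠ ρ := by intro hh; subst hh; omega
    simp [h1, h2]
  · simp [hκ]

/-- [folklore] Consecutive sites of stage `ρ` differ by `e_ρ`. -/
theorem mixK_step (k : Fin d → ℕ) (ρ : Fin d) (j : ℕ) :
    mixK k ρ (j + 1) = mixK k ρ j + Pi.single ρ 1 := by
  funext κ
  simp only [mixK, Pi.add_apply]
  by_cases h2 : κ = ρ
  · subst h2; simp
  · have : (Pi.single ρ (1 : ℕ) : Fin d → ℕ) κ = 0 := by simp [h2]
    rw [this]
    by_cases h1 : (κ : ℕ) < ρ
    · simp [h1]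
    · simp [h1, h2]

/-- [folklore] The last site of stage `ρ`. -/
theorem mixK_top (k : Fin d → ℕ) (ρ : Fin d) : mixK k ρ (k ρ) = trunc k ρ := by
  funext κ
  simp only [mixK, trunc]
  by_cases h1 : (κ : ℕ) < ρ
  · simp [h1]
  · by_cases h2 : κ = ρ
    · subst h2; simp
    · simp [h1, h2]

/-- [folklore] The first site of stage `ρ` is the last site of stage `ρ + 1`. -/
theorem mixK_zero (k : Fin d → ℕ) (ρ : Fin d) : mixK k ρ 0 = trunc k ((ρ : ℕ) + 1) := by
  funext κ
  simp only [mixK, trunc]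
  by_cases h1 : (κ : ℕ) < ρ
  · have : (κ : ℕ) < (ρ : ℕ) + 1 := by omega
    simp [h1, this]
  · by_cases h2 : κ = ρ
    · subst h2; simp
    · have h3 : ¬ (κ : ℕ) < (ρ : ℕ) + 1 := by
        intro hh; apply h2; exact Fin.ext (by omega)
      simp [h1, h2, h3]

/-- [folklore] Resetting no coordinate. -/
theorem trunc_zero (k : Fin d → ℕ) : trunc k 0 = k := by
  funext κ; simp [trunc]

/-- [folklore] Telescoping over the stages `ρ < ν` (as a sum over `Fin d`). -/
theorem sum_filter_lt_telescope (ν : Fin d) (G : ℕ → ℝ) :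
    ∑ ρ ∈ univ.filter (fun ρ : Fin d => (ρ : ℕ) < ν), (G ρ - G (ρ + 1)) = G 0 - G ν := by
  rw [Finset.sum_filter]
  have h1 : ∑ ρ : Fin d, (if (ρ : ℕ) < ν then G ρ - G (ρ + 1) else 0)
      = ∑ i ∈ range d, (if i < (ν : ℕ) then G i - G (i + 1) else 0) :=
    Fin.sum_univ_eq_sum_range (fun i => if i < (ν : ℕ) then G i - G (i + 1) else 0) d
  rw [h1, ← Finset.sum_filter]
  have h2 : (range d).filter (fun i => i < (ν : ℕ)) = range ν := by
    ext i
    simp only [Finset.mem_filter, Finset.mem_range]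
    constructor
    · rintro ⟨-, h⟩; exact h
    · intro h; exact ⟨lt_trans h ν.isLt, h⟩
  rw [h2, Finset.sum_range_sub']

/-- [cite: Balaban1985RegularSpaces, Lemma 1 proof p.79; Balaban1985Averaging pp.24–25] **Discrete Stokes for
the staircase tree** (the content of "the same reasoning as in [3] (between (44) and (46))"):
`θ(Γ_{z,x+e_ν}) − θ(Γ_{z,x}) = θ⟨x,x+e_ν⟩ − Σ_{ladder} (∂θ)(p)`. -/
theorem stokes_tree (θ : Config d) (z : Site d) (k : Fin d → ℕ) (ν : Fin d) :
    treeSum θ z (k + Pi.single ν 1) - treeSum θ z k = θ (site z k) ν - ladder θ z k ν := by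
  set k' := k + Pi.single ν 1 with hk'
  have hk'ν : k' ν = k ν + 1 := by simp [hk']
  have hk'ne : ∀ ρ : Fin d, ρ ≠ ν → k' ρ = k ρ := fun ρ h => by simp [hk', h]
  set G : ℕ → ℝ := fun m => θ (site z (trunc k m)) ν with hG
  have hD : ∀ ρ : Fin d,
      (∑ j ∈ range (k' ρ), θ (site z (mixK k' ρ j)) ρ) - ∑ j ∈ range (k ρ), θ (site z (mixK k ρ j)) ρ
        = (if (ρ : ℕ) < ν then (G ρ - G (ρ + 1)) - ∑ j ∈ range (k ρ), plaq θ (site z (mixK k ρ j)) ρ ν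
            else 0)
          + (if ρ = ν then θ (site z (trunc k ν)) ν else 0) := by
    intro ρ
    by_cases h1 : (ρ : ℕ) < ν
    · have hρν : ρ ≠ ν := by intro h; subst h; exact lt_irrefl _ h1
      rw [if_pos h1, if_neg hρν, add_zero, hk'ne ρ hρν, ← Finset.sum_sub_distrib]
      have hterm : ∀ j, θ (site z (mixK k' ρ j)) ρ - θ (site z (mixK k ρ j)) ρ
          = (θ (site z (mixK k ρ (j + 1))) ν - θ (site z (mixK k ρ j)) ν)
            - plaq θ (site z (mixK k ρ j)) ρ ν := by
        intro j
        rw [hk', mixK_succ_of_gt h1, site_add_single, mixK_step, site_add_single]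
        simp only [plaq]; ring
      rw [Finset.sum_congr rfl (fun j _ => hterm j), Finset.sum_sub_distrib,
        Finset.sum_range_sub (fun j => θ (site z (mixK k ρ j)) ν), mixK_top, mixK_zero]
    · by_cases h2 : ρ = ν
      · subst h2
        rw [if_neg h1, if_pos rfl, zero_add, hk'ν, Finset.sum_range_succ]
        have hmix : ∀ j, mixK k' ρ j = mixK k ρ j := fun j => by rw [hk', mixK_succ_self]
        simp_rw [hmix]
        rw [mixK_top]; ring
      · have hgt : (ν : ℕ) < ρ := by
          have : (ρ : ℕ) ≠ ν := fun hh => h2 (Fin.ext hh)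
          omega
        rw [if_neg h1, if_neg h2, add_zero, hk'ne ρ h2]
        have hmix : ∀ j, mixK k' ρ j = mixK k ρ j := fun j => by rw [hk', mixK_succ_of_lt hgt]
        simp_rw [hmix]
        ring
  unfold treeSum
  rw [← Finset.sum_sub_distrib, Finset.sum_congr rfl (fun ρ _ => hD ρ), Finset.sum_add_distrib,
    Finset.sum_ite_eq' univ ν, if_pos (Finset.mem_univ ν), ← Finset.sum_filter,
    Finset.sum_sub_distrib, sum_filter_lt_telescope ν G]
  simp only [ladder, hG, trunc_zero]
  ring

/-- [cite: Balaban1985RegularSpaces, Lemma 1 proof p.79] In particular (corollary of `stokes_tree`): the bond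
`⟨x, x+e_ν⟩` equals `θ(Γ_{z,x+e_ν}) − θ(Γ_{z,x}) + ladder`. -/
theorem bond_eq (θ : Config d) (z : Site d) (k : Fin d → ℕ) (ν : Fin d) :
    θ (site z k) ν = treeSum θ z (k + Pi.single ν 1) - treeSum θ z k + ladder θ z k ν := by
  have := stokes_tree θ z k ν; linarith


/-! ### §2 Blocks, the axial (tree) gauge and the interior bound -/

/-- [cite: Balaban1985Averaging, p.24] Corner-anchored block `B(z) = z + {0,…,L−1}^d` of the unit lattice
(p. 24: "2^d blocks having the point y as one of the corners"). -/
def InBlock (L : ℕ) (z x : Site d) : Prop := ∀ κ, z κ ≤ x κ ∧ x κ < z κ + L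

/-- [folklore] `site z k ∈ B(z)` iff all offsets are `< L`. -/
theorem inBlock_site_iff (L : ℕ) (z : Site d) (k : Fin d → ℕ) :
    InBlock L z (site z k) ↔ ∀ κ, k κ < L := by
  simp only [InBlock, site]
  constructor
  · intro h κ; have := (h κ).2; omega
  · intro h κ; have := h κ; constructor <;> omega

/-- [folklore] Every site of `B(z)` has offsets `< L` from the corner. -/
theorem exists_offset_of_inBlock {L : ℕ} {z x : Site d} (h : InBlock L z x) :
    ∃ k : Fin d → ℕ, (∀ κ, k κ < L) ∧ site z k = x := by
  refine ⟨fun κ => (x κ - z κ).toNat, ?_, ?_⟩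
  · intro κ; have := h κ; show (x κ - z κ).toNat < L; omega
  · funext κ; have := h κ; simp only [site]; omega

/-- [folklore] One more step in direction `ρ` stays in the block when `k ρ + 1 < L`. -/
theorem lt_of_add_single {L : ℕ} {k : Fin d → ℕ} (hk : ∀ κ, k κ < L) {ρ : Fin d} (hρ : k ρ + 1 < L) :
    ∀ κ, (k + Pi.single ρ 1 : Fin d → ℕ) κ < L := by
  intro κ; by_cases h : κ = ρ
  · subst h; simpa using hρ
  · simp [h, hk κ]

/-- [folklore] Coordinate `ρ` of the `j`-th site of stage `ρ`. -/
theorem mixK_apply_self (k : Fin d → ℕ) (ρ : Fin d) (j : ℕ) : mixK k ρ j ρ = j := by simp [mixK]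

/-- [folklore] Coordinates `> ρ` of the sites of stage `ρ` are those of the endpoint. -/
theorem mixK_apply_of_gt (k : Fin d → ℕ) {ρ κ : Fin d} (h : (ρ : ℕ) < κ) (j : ℕ) : mixK k ρ j κ = k κ := by
  have h1 : ¬ (κ : ℕ) < ρ := by omega
  have h2 : κ ≠ ρ := by intro hh; subst hh; omega
  simp [mixK, h1, h2]

/-- [folklore] The tree `Γ_{z,x}`, `x ∈ B(z)`, stays in `B(z)`. -/
theorem mixK_lt {L : ℕ} {k : Fin d → ℕ} (hk : ∀ κ, k κ < L) (ρ : Fin d) {j : ℕ} (hj : j < L) :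
    ∀ κ, mixK k ρ j κ < L := by
  intro κ; have := hk κ; have := hk ρ
  simp only [mixK]; split_ifs <;> omega

/-- [cite: Balaban1985RegularSpaces, (1.24) p.79] The axial (tree) gauge of (1.24) in the additive model:
`θ(Γ_{z,x}) = 0` for every `x ∈ B(z)` ("(R(V₀)V′)(Γ_{y,x}) = 1 for x ∈ B(y)"). -/
def TreeGauge (L : ℕ) (θ : Config d) (z : Site d) : Prop :=
  ∀ k : Fin d → ℕ, (∀ κ, k κ < L) → treeSum θ z k = 0

/-- [cite: Balaban1985RegularSpaces, (1.26) p.79] A bound `|∂θ(p)| ≤ Pb` on the plaquettes of `B(z)`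
(all four corners in `B(z)`); (1.26) supplies `Pb = 2α₀L⁻²` for the perturbation. -/
def PlaqBound (L : ℕ) (θ : Config d) (z : Site d) (Pb : ℝ) : Prop :=
  ∀ x : Site d, ∀ ρ ν : Fin d, ρ ≠ ν → InBlock L z x → InBlock L z (x + e ρ) → InBlock L z (x + e ν) →
    InBlock L z (x + e ρ + e ν) → |plaq θ x ρ ν| ≤ Pb

/-- [cite: Balaban1985RegularSpaces, Lemma 1 proof p.79] Under the tree gauge an interior bond `⟨x, x+e_ν⟩`
(`x, x+e_ν ∈ B(z)`) equals the ladder sum of plaquette circulations. -/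
theorem bond_eq_ladder {L : ℕ} {θ : Config d} {z : Site d} (hT : TreeGauge L θ z) (k : Fin d → ℕ)
    (hk : ∀ κ, k κ < L) (ν : Fin d) (hν : k ν + 1 < L) : θ (site z k) ν = ladder θ z k ν := by
  rw [bond_eq θ z k ν, hT k hk, hT _ (lt_of_add_single hk hν)]; ring

/-- [cite: Balaban1985RegularSpaces, Lemma 1 proof p.79] "The conditions (R₀V′)(Γ_{y,x}) = 1, x ∈ B(y), imply
V′_b = 1 for b ⊂ Γ_{y,x}": a tree bond (all coordinates of index `< ν` at the corner) vanishes. -/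
theorem treeBond_eq_zero {L : ℕ} {θ : Config d} {z : Site d} (hT : TreeGauge L θ z) (k : Fin d → ℕ)
    (hk : ∀ κ, k κ < L) (ν : Fin d) (hν : k ν + 1 < L) (htree : ∀ κ : Fin d, (κ : ℕ) < ν → k κ = 0) :
    θ (site z k) ν = 0 := by
  rw [bond_eq_ladder hT k hk ν hν]
  unfold ladder
  apply Finset.sum_eq_zero
  intro ρ hρ
  rw [Finset.mem_filter] at hρ
  rw [htree ρ hρ.2]
  simp

/-- [cite: Balaban1985RegularSpaces, Lemma 1 proof p.79] The ladder has `Σ_{ρ<ν} k ρ ≤ (d−1)(L−1)` plaquettes: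
`|ladder| ≤ (d−1)(L−1)·Pb`. -/
theorem abs_ladder_le {L : ℕ} {θ : Config d} {z : Site d} {Pb : ℝ} (hP : PlaqBound L θ z Pb) (hPb : 0 ≤ Pb)
    (k : Fin d → ℕ) (hk : ∀ κ, k κ < L) (ν : Fin d) (hν : k ν + 1 < L) :
    |ladder θ z k ν| ≤ ((d : ℝ) - 1) * ((L : ℝ) - 1) * Pb := by
  unfold ladder
  set F := univ.filter (fun ρ : Fin d => (ρ : ℕ) < ν) with hF
  have hcorner : ∀ ρ : Fin d, (ρ : ℕ) < ν → ∀ j, j < k ρ →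
      |plaq θ (site z (mixK k ρ j)) ρ ν| ≤ Pb := by
    intro ρ hρ j hj
    have hρν : ρ ≠ ν := by intro h; subst h; exact lt_irrefl _ hρ
    have hq : ∀ κ, mixK k ρ j κ < L := mixK_lt hk ρ (lt_trans hj (hk ρ))
    have hqρ : mixK k ρ j ρ + 1 < L := by rw [mixK_apply_self]; have := hk ρ; omega
    have hqν : mixK k ρ j ν + 1 < L := by rw [mixK_apply_of_gt k hρ]; exact hν
    have hqρν : (mixK k ρ j + Pi.single ρ 1 : Fin d → ℕ) ν + 1 < L := by
      have : (Pi.single ρ (1 : ℕ) : Fin d → ℕ) ν = 0 := by simp [hρν.symm]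
      rw [Pi.add_apply, this, add_zero]; exact hqν
    apply hP _ _ _ hρν
    · exact (inBlock_site_iff L z _).2 hq
    · rw [← site_add_single]; exact (inBlock_site_iff L z _).2 (lt_of_add_single hq hqρ)
    · rw [← site_add_single]; exact (inBlock_site_iff L z _).2 (lt_of_add_single hq hqν)
    · rw [← site_add_single, ← site_add_single]
      exact (inBlock_site_iff L z _).2 (lt_of_add_single (lt_of_add_single hq hqρ) hqρν)
  have hLr : ∀ ρ : Fin d, ((k ρ : ℕ) : ℝ) ≤ (L : ℝ) - 1 := by
    intro ρ
    have : (k ρ : ℝ) + 1 ≤ L := by exact_mod_cast hk ρ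
    linarith
  have hd : 1 ≤ d := by have := ν.isLt; omega
  have hL1 : (1 : ℝ) ≤ L := by have := hk ν; exact_mod_cast (show 1 ≤ L by omega)
  have hcard : (F.card : ℝ) ≤ (d : ℝ) - 1 := by
    have hsub : F ⊆ univ.erase ν := by
      intro ρ hρ
      rw [hF, Finset.mem_filter] at hρ
      rw [Finset.mem_erase]
      exact ⟨by intro h; rw [h] at hρ; exact lt_irrefl _ hρ.2, Finset.mem_univ _⟩
    have h1 := Finset.card_le_card hsub
    rw [Finset.card_erase_of_mem (Finset.mem_univ ν), Finset.card_univ, Fintype.card_fin] at h1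
    have h2 : (F.card : ℝ) ≤ ((d - 1 : ℕ) : ℝ) := by exact_mod_cast h1
    rwa [Nat.cast_sub hd, Nat.cast_one] at h2
  calc |∑ ρ ∈ F, ∑ j ∈ range (k ρ), plaq θ (site z (mixK k ρ j)) ρ ν|
      ≤ ∑ ρ ∈ F, |∑ j ∈ range (k ρ), plaq θ (site z (mixK k ρ j)) ρ ν| := Finset.abs_sum_le_sum_abs _ _
    _ ≤ ∑ ρ ∈ F, ∑ j ∈ range (k ρ), |plaq θ (site z (mixK k ρ j)) ρ ν| :=
        Finset.sum_le_sum fun ρ _ => Finset.abs_sum_le_sum_abs _ _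
    _ ≤ ∑ ρ ∈ F, ∑ _j ∈ range (k ρ), Pb := by
        apply Finset.sum_le_sum; intro ρ hρ
        apply Finset.sum_le_sum; intro j hj
        exact hcorner ρ (by rw [hF, Finset.mem_filter] at hρ; exact hρ.2) j (Finset.mem_range.1 hj)
    _ = ∑ ρ ∈ F, (k ρ : ℝ) * Pb := by simp [Finset.sum_const, Finset.card_range]
    _ ≤ ∑ _ρ ∈ F, ((L : ℝ) - 1) * Pb := by
        apply Finset.sum_le_sum; intro ρ _
        exact mul_le_mul_of_nonneg_right (hLr ρ) hPb
    _ = (F.card : ℝ) * (((L : ℝ) - 1) * Pb) := by simp [Finset.sum_const]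
    _ ≤ ((d : ℝ) - 1) * (((L : ℝ) - 1) * Pb) := by
        apply mul_le_mul_of_nonneg_right hcard
        exact mul_nonneg (by linarith) hPb
    _ = ((d : ℝ) - 1) * ((L : ℝ) - 1) * Pb := by ring

/-- [cite: Balaban1985RegularSpaces, Lemma 1 proof p.79] The printed interior bound
"|V′_b − 1| < (d−1)(L−1)2α₀L⁻² for b ⊂ B(y)" in the additive model (with `Pb` for `2α₀L⁻²`). -/
theorem interior_bound {L : ℕ} {θ : Config d} {z : Site d} {Pb : ℝ} (hT : TreeGauge L θ z)
    (hP : PlaqBound L θ z Pb) (hPb : 0 ≤ Pb) (k : Fin d → ℕ) (hk : ∀ κ, k κ < L) (ν : Fin d)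
    (hν : k ν + 1 < L) : |θ (site z k) ν| ≤ ((d : ℝ) - 1) * ((L : ℝ) - 1) * Pb := by
  rw [bond_eq_ladder hT k hk ν hν]; exact abs_ladder_le hP hPb k hk ν hν


/-! ### §3 Two neighbouring blocks `B(c₋) = B(y)`, `B(c₊) = B(y + L e_μ)`: contours (42), the average,
the crossing bonds (1.23) -/

/-- [cite: Balaban1985RegularSpaces, (1.23) p.79] Corner of `B(c₊) = B(c₋) + L e_μ` for the coarse bond
`c = ⟨y, y + L e_μ⟩` (`y` = corner of `B(c₋)`). -/
def yplus (L : ℕ) (y : Site d) (μ : Fin d) : Site d := site y (Pi.single μ L)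

/-- [cite: Balaban1985RegularSpaces, p.80 l.3–5] The region of the locality remark: `B(c₋) ∪ B(c₊)`. -/
def InPair (L : ℕ) (y : Site d) (μ : Fin d) (x : Site d) : Prop :=
  InBlock L y x ∨ InBlock L (yplus L y μ) x

/-- [cite: Balaban1985RegularSpaces, (1.23) p.79] Transverse positions of the crossing bonds `B(c)` of (1.23)
(`L^{d−1}` of them): a coordinate in `{0,…,L−1}` for every direction `ν ≠ μ`. -/
abbrev Trans (d L : ℕ) (μ : Fin d) : Type := {ν : Fin d // ν ≠ μ} → Fin L

/-- [folklore] Offsets (from the corner) of the site with transverse position `t` and longitudinal coordinate `h`. -/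
def offset {L : ℕ} (μ : Fin d) (t : Trans d L μ) (h : ℕ) : Fin d → ℕ :=
  fun κ => if hκ : κ = μ then h else (t ⟨κ, hκ⟩ : ℕ)

/-- [folklore] The longitudinal coordinate of `offset t h` is `h`. -/
theorem offset_apply_mu {L : ℕ} (μ : Fin d) (t : Trans d L μ) (h : ℕ) : offset μ t h μ = h := by
  simp [offset]

/-- [folklore] The transverse coordinates of `offset t h` are those of `t`. -/
theorem offset_apply_ne {L : ℕ} (μ : Fin d) (t : Trans d L μ) (h : ℕ) {κ : Fin d} (hκ : κ ≠ μ) :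
    offset μ t h κ = t ⟨κ, hκ⟩ := by
  simp [offset, hκ]

/-- [folklore] The transverse coordinates of `offset t h` are those of `t` (subtype form). -/
theorem offset_apply_sub {L : ℕ} (μ : Fin d) (t : Trans d L μ) (h : ℕ) (ν : {ν : Fin d // ν ≠ μ}) :
    offset μ t h ν.1 = t ν := by
  simp [offset, ν.2]

/-- [folklore] `offset t h` lies in the block for `h < L`. -/
theorem offset_lt {L : ℕ} (μ : Fin d) (t : Trans d L μ) {h : ℕ} (hh : h < L) : ∀ κ, offset μ t h κ < L := by
  intro κ; by_cases hκ : κ = μ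
  · subst hκ; rw [offset_apply_mu]; exact hh
  · rw [offset_apply_ne μ t h hκ]; exact (t ⟨κ, hκ⟩).isLt

/-- [folklore] A longitudinal step raises the longitudinal coordinate. -/
theorem offset_add_single {L : ℕ} (μ : Fin d) (t : Trans d L μ) (h i : ℕ) :
    offset μ t h + Pi.single μ i = offset μ t (h + i) := by
  funext κ; by_cases hκ : κ = μ
  · subst hκ; simp [offset]
  · simp [offset, hκ]

/-- [folklore] A longitudinal step raises the longitudinal coordinate (commuted form). -/
theorem single_add_offset {L : ℕ} (μ : Fin d) (t : Trans d L μ) (h i : ℕ) :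
    Pi.single μ i + offset μ t h = offset μ t (h + i) := by
  rw [add_comm]; exact offset_add_single μ t h i

/-- [folklore] `site y (offset t (h + L)) = site (c₊-corner) (offset t h)`: the same transverse position seen from `B(c₊)`. -/
theorem site_offset_add (L : ℕ) (y : Site d) (μ : Fin d) (t : Trans d L μ) (h : ℕ) :
    site y (offset μ t (h + L)) = site (yplus L y μ) (offset μ t h) := by
  rw [yplus, site_site, single_add_offset]

/-- [folklore] One transverse step `u = t + e_ν` translates every `offset` by `e_ν`. -/
theorem offset_step {L : ℕ} (μ : Fin d) {t u : Trans d L μ} (ν : {ν : Fin d // ν ≠ μ})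
    (hu : ∀ κ, κ ≠ ν → u κ = t κ) (hν : (u ν : ℕ) = t ν + 1) (h : ℕ) :
    offset μ u h = offset μ t h + Pi.single ν.1 1 := by
  funext κ
  by_cases hκ : κ = μ
  · subst hκ
    have : (Pi.single ν.1 (1 : ℕ) : Fin d → ℕ) κ = 0 := by simp [Ne.symm ν.2]
    simp [offset, this]
  · by_cases hκν : κ = ν.1
    · subst hκν
      simp [offset, ν.2, hν]
    · have hne : (⟨κ, hκ⟩ : {ν : Fin d // ν ≠ μ}) ≠ ν := by
        intro hh; apply hκν; rw [← hh]
      have : (Pi.single ν.1 (1 : ℕ) : Fin d → ℕ) κ = 0 := by simp [hκν]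
      simp [offset, hκ, this, hu _ hne]

/-- [cite: Balaban1985Averaging, (14) p.19] The segment `[x, x(c)]`, `x(c) = x + L e_μ`: its `L` bonds (offsets `q` of `x`). -/
def segment (L : ℕ) (y : Site d) (μ : Fin d) (θ : Config d) (q : Fin d → ℕ) : ℝ :=
  ∑ i ∈ range L, θ (site y (q + Pi.single μ i)) μ

/-- [cite: Balaban1985Averaging, (42) p.23; contour Γ_{c,x} p.19] `θ(Γ_{c,x})` for
`Γ_{c,x} = Γ_{c₋,x} ∪ [x, x(c)] ∪ Γ_{x(c),c₊}`; the last piece is `Γ_{c₊,x(c)}` reversed (a minus sign in the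
additive model), and `x(c)` has the same offsets from `c₊` as `x` from `c₋`. -/
def contourSum (L : ℕ) (y : Site d) (μ : Fin d) (θ : Config d) (q : Fin d → ℕ) : ℝ :=
  treeSum θ y q + segment L y μ θ q - treeSum θ (yplus L y μ) q

/-- [cite: Balaban1985Averaging, (42) p.23] The block average (42)
`exp[i Σ_{x∈B(c₋)} L^{−d} (1/i) log U(Γ_{c,x})U(c)^{−1}] U(c)` in the additive model: the arithmetic mean of
`θ(Γ_{c,x})` over `x ∈ B(c₋)` (the `L^d` sites parametrised by transverse position and longitudinal coordinate). -/
noncomputable def avg (L : ℕ) (y : Site d) (μ : Fin d) (θ : Config d) : ℝ :=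
  (∑ t : Trans d L μ, ∑ h : Fin L, contourSum L y μ θ (offset μ t h)) /
    ((Fintype.card (Trans d L μ) : ℝ) * L)

/-- [cite: Balaban1985RegularSpaces, (1.23) p.79] The value of the crossing bond of `B(c)` at transverse
position `t`: `⟨site y (offset t (L−1)), · + e_μ⟩`. -/
def crossVal (L : ℕ) (y : Site d) (μ : Fin d) (θ : Config d) (t : Trans d L μ) : ℝ :=
  θ (site y (offset μ t (L - 1))) μ

/-- [folklore] The `L − 1` interior bonds of the segment through `(t, h)` (all bonds except the crossing one,
which sits at longitudinal index `L − 1 − h`). -/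
def interiorPart (L : ℕ) (y : Site d) (μ : Fin d) (θ : Config d) (t : Trans d L μ) (h : ℕ) : ℝ :=
  ∑ i ∈ (range L).erase (L - 1 - h), θ (site y (offset μ t h + Pi.single μ i)) μ

/-- [folklore] Tree holonomies are additive in the configuration (abelian model). -/
theorem treeSum_add (θ₀ θ' : Config d) (z : Site d) (k : Fin d → ℕ) :
    treeSum (θ₀ + θ') z k = treeSum θ₀ z k + treeSum θ' z k := by
  simp [treeSum, Finset.sum_add_distrib]

/-- [folklore] Segment holonomies are additive in the configuration (abelian model). -/
theorem segment_add (L : ℕ) (y : Site d) (μ : Fin d) (θ₀ θ' : Config d) (q : Fin d → ℕ) :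
    segment L y μ (θ₀ + θ') q = segment L y μ θ₀ q + segment L y μ θ' q := by
  simp [segment, Finset.sum_add_distrib]

/-- [folklore] Contour holonomies are additive in the configuration (abelian model). -/
theorem contourSum_add (L : ℕ) (y : Site d) (μ : Fin d) (θ₀ θ' : Config d) (q : Fin d → ℕ) :
    contourSum L y μ (θ₀ + θ') q = contourSum L y μ θ₀ q + contourSum L y μ θ' q := by
  simp only [contourSum, treeSum_add, segment_add]; ring

/-- [folklore] Linearity of the additive average: `avg(θ₀ + θ') − avg θ₀ = avg θ'`
(the additive shadow of `(V′V₀)‾ (V̄₀)^{−1} = Ṽ′`, (1.20) p. 79). -/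
theorem avg_add_sub (L : ℕ) (y : Site d) (μ : Fin d) (θ₀ θ' : Config d) :
    avg L y μ (θ₀ + θ') - avg L y μ θ₀ = avg L y μ θ' := by
  simp only [avg, contourSum_add, Finset.sum_add_distrib]
  ring

/-- [cite: Balaban1985RegularSpaces, Lemma 1 proof p.79] The segment splits into the crossing bond and the
`L − 1` interior bonds. -/
theorem segment_split {L : ℕ} (y : Site d) (μ : Fin d) (θ : Config d) (t : Trans d L μ) {h : ℕ} (hh : h < L) :
    segment L y μ θ (offset μ t h) = crossVal L y μ θ t + interiorPart L y μ θ t h := by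
  unfold segment crossVal interiorPart
  have hmem : L - 1 - h ∈ range L := by rw [Finset.mem_range]; omega
  rw [← Finset.add_sum_erase _ _ hmem, offset_add_single, show h + (L - 1 - h) = L - 1 by omega]

/-- [cite: Balaban1985RegularSpaces, Lemma 1 proof p.79] Under the axial gauge in both blocks the contour
holonomy of the perturbation is the segment alone: `θ'(Γ_{c,x}) = θ'([x, x(c)])`. -/
theorem contourSum_eq_segment {L : ℕ} {y : Site d} {μ : Fin d} {θ : Config d} (hT : TreeGauge L θ y)
    (hT' : TreeGauge L θ (yplus L y μ)) (t : Trans d L μ) {h : ℕ} (hh : h < L) :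
    contourSum L y μ θ (offset μ t h) = segment L y μ θ (offset μ t h) := by
  unfold contourSum
  rw [hT _ (offset_lt μ t hh), hT' _ (offset_lt μ t hh)]; ring

/-- [folklore] A (possibly mixed) plaquette bound on the region `B(c₋) ∪ B(c₊)`. -/
def PlaqBoundPair (L : ℕ) (y : Site d) (μ : Fin d) (θ : Config d) (Pb : ℝ) : Prop :=
  ∀ x : Site d, ∀ ρ ν : Fin d, ρ ≠ ν → InPair L y μ x → InPair L y μ (x + e ρ) → InPair L y μ (x + e ν) →
    InPair L y μ (x + e ρ + e ν) → |plaq θ x ρ ν| ≤ Pb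

/-- [folklore] A bound on the region restricts to `B(c₋)`. -/
theorem plaqBound_left {L : ℕ} {y : Site d} {μ : Fin d} {θ : Config d} {Pb : ℝ}
    (h : PlaqBoundPair L y μ θ Pb) : PlaqBound L θ y Pb :=
  fun x ρ ν hρν h1 h2 h3 h4 => h x ρ ν hρν (Or.inl h1) (Or.inl h2) (Or.inl h3) (Or.inl h4)

/-- [folklore] A bound on the region restricts to `B(c₊)`. -/
theorem plaqBound_right {L : ℕ} {y : Site d} {μ : Fin d} {θ : Config d} {Pb : ℝ}
    (h : PlaqBoundPair L y μ θ Pb) : PlaqBound L θ (yplus L y μ) Pb :=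
  fun x ρ ν hρν h1 h2 h3 h4 => h x ρ ν hρν (Or.inr h1) (Or.inr h2) (Or.inr h3) (Or.inr h4)

/-- [cite: Balaban1985RegularSpaces, Lemma 1 proof p.79] Each non-crossing bond of a segment `[x, x(c)]` is an
interior bond of `B(c₋)` or of `B(c₊)` (longitudinal offset `m ≠ L − 1`, `m ≤ 2L − 2`). -/
theorem abs_segBond_le {L : ℕ} {y : Site d} {μ : Fin d} {θ : Config d} {Pb : ℝ}
    (hT : TreeGauge L θ y) (hT' : TreeGauge L θ (yplus L y μ)) (hP : PlaqBoundPair L y μ θ Pb) (hPb : 0 ≤ Pb)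
    (t : Trans d L μ) {m : ℕ} (hm : m + 1 ≠ L) (hm2 : m + 2 ≤ 2 * L) :
    |θ (site y (offset μ t m)) μ| ≤ ((d : ℝ) - 1) * ((L : ℝ) - 1) * Pb := by
  by_cases hlow : m + 1 < L
  · exact interior_bound hT (plaqBound_left hP) hPb (offset μ t m) (offset_lt μ t (by omega)) μ
      (by rw [offset_apply_mu]; exact hlow)
  · obtain ⟨m', hm'⟩ : ∃ m', m = m' + L := ⟨m - L, by omega⟩
    rw [hm', site_offset_add]
    exact interior_bound hT' (plaqBound_right hP) hPb (offset μ t m') (offset_lt μ t (by omega)) μ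
      (by rw [offset_apply_mu]; omega)

/-- [cite: Balaban1985RegularSpaces, Lemma 1 proof p.79] The interior bonds of a segment: each of the `L − 1`
bonds of `[x, x(c)]` other than the crossing one lies inside `B(c₋)` or inside `B(c₊)`, hence
`|interiorPart| ≤ (L−1)·I` with `I = (d−1)(L−1)·Pb`. -/
theorem abs_interiorPart_le {L : ℕ} {y : Site d} {μ : Fin d} {θ : Config d} {Pb : ℝ}
    (hT : TreeGauge L θ y) (hT' : TreeGauge L θ (yplus L y μ)) (hP : PlaqBoundPair L y μ θ Pb) (hPb : 0 ≤ Pb)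
    (t : Trans d L μ) {h : ℕ} (hh : h < L) :
    |interiorPart L y μ θ t h| ≤ ((L : ℝ) - 1) * (((d : ℝ) - 1) * ((L : ℝ) - 1) * Pb) := by
  unfold interiorPart
  have hmem : L - 1 - h ∈ range L := by rw [Finset.mem_range]; omega
  have hterm : ∀ i ∈ (range L).erase (L - 1 - h),
      |θ (site y (offset μ t h + Pi.single μ i)) μ| ≤ ((d : ℝ) - 1) * ((L : ℝ) - 1) * Pb := by
    intro i hi
    rw [Finset.mem_erase, Finset.mem_range] at hi
    rw [offset_add_single]
    exact abs_segBond_le hT hT' hP hPb t (by omega) (by omega)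
  have h1 := Finset.abs_sum_le_sum_abs (fun i => θ (site y (offset μ t h + Pi.single μ i)) μ)
    ((range L).erase (L - 1 - h))
  have h2 := Finset.sum_le_card_nsmul _ _ _ hterm
  rw [Finset.card_erase_of_mem hmem, Finset.card_range, nsmul_eq_mul, Nat.cast_sub (by omega : 1 ≤ L),
    Nat.cast_one] at h2
  exact h1.trans h2

/-- [folklore] One transverse step between crossing bonds: `u = t ± e_ν` for a direction `ν ≠ μ`. -/
def StepAdj {L : ℕ} {μ : Fin d} (t u : Trans d L μ) : Prop :=
  ∃ ν : {ν : Fin d // ν ≠ μ}, (∀ κ, κ ≠ ν → u κ = t κ) ∧ ((u ν : ℕ) = t ν + 1 ∨ (t ν : ℕ) = u ν + 1)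

/-- [cite: Balaban1985RegularSpaces, Lemma 1 proof p.79] "For a plaquette p connecting two neighboring blocks
B(c₋), B(c₊) we take two bonds b′, b″ ⊂ ∂p, b′, b″ ∈ B(c) … |R(V₀(b′₋,b″₋))V′_{b″} − V′_{b′}| < 2α₀L⁻² +
4(d−1)α₀L⁻¹": neighbouring crossing bonds differ by one plaquette and two interior bonds, `≤ Pb + 2I`. -/
theorem crossVal_step {L : ℕ} {y : Site d} {μ : Fin d} {θ : Config d} {Pb : ℝ}
    (hT : TreeGauge L θ y) (hT' : TreeGauge L θ (yplus L y μ)) (hP : PlaqBoundPair L y μ θ Pb) (hPb : 0 ≤ Pb)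
    (hL : 1 ≤ L) {t u : Trans d L μ} (hadj : StepAdj t u) :
    |crossVal L y μ θ t - crossVal L y μ θ u| ≤ Pb + 2 * (((d : ℝ) - 1) * ((L : ℝ) - 1) * Pb) := by
  set I : ℝ := ((d : ℝ) - 1) * ((L : ℝ) - 1) * Pb with hI
  -- the oriented case u = t + e_ν
  have key : ∀ t u : Trans d L μ, ∀ ν : {ν : Fin d // ν ≠ μ}, (∀ κ, κ ≠ ν → u κ = t κ) →
      (u ν : ℕ) = t ν + 1 → |crossVal L y μ θ t - crossVal L y μ θ u| ≤ Pb + 2 * I := by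
    intro t u ν hu hν
    have hL1 : L - 1 < L := by omega
    set q := offset μ t (L - 1) with hq
    have hqlt : ∀ κ, q κ < L := offset_lt μ t hL1
    have hqν : q ν.1 + 1 < L := by
      rw [hq, offset_apply_sub]; have := (u ν).isLt; omega
    -- the four bonds of the plaquette (site y q; ν, μ)
    have hx1 : site y q + e ν.1 = site y (offset μ u (L - 1)) := by
      rw [offset_step μ ν hu hν, site_add_single]
    have hx2 : site y q + e μ = site (yplus L y μ) (offset μ t 0) := by
      rw [← site_add_single, hq, offset_add_single, ← site_offset_add, show L - 1 + 1 = 0 + L by omega]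
    have hplaq : |plaq θ (site y q) ν.1 μ| ≤ Pb := by
      apply hP _ _ _ ν.2
      · exact Or.inl ((inBlock_site_iff L y q).2 hqlt)
      · rw [← site_add_single]; exact Or.inl ((inBlock_site_iff L y _).2 (lt_of_add_single hqlt hqν))
      · rw [hx2]; exact Or.inr ((inBlock_site_iff L _ _).2 (offset_lt μ t hL))
      · rw [add_assoc, add_comm (e ν.1), ← add_assoc, hx2, ← site_add_single]
        refine Or.inr ((inBlock_site_iff L _ _).2 (lt_of_add_single (offset_lt μ t hL) ?_))
        rw [offset_apply_sub]; have := (u ν).isLt; omega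
    have hb1 : |θ (site y q) ν.1| ≤ I := interior_bound hT (plaqBound_left hP) hPb q hqlt ν.1 hqν
    have hb2 : |θ (site y q + e μ) ν.1| ≤ I := by
      rw [hx2]
      refine interior_bound hT' (plaqBound_right hP) hPb _ (offset_lt μ t hL) ν.1 ?_
      rw [offset_apply_sub]; have := (u ν).isLt; omega
    have hident : crossVal L y μ θ t - crossVal L y μ θ u
        = -(plaq θ (site y q) ν.1 μ) + θ (site y q) ν.1 - θ (site y q + e μ) ν.1 := by
      simp only [crossVal, plaq, ← hx1, ← hq]; ring
    rw [hident]
    calc |-(plaq θ (site y q) ν.1 μ) + θ (site y q) ν.1 - θ (site y q + e μ) ν.1|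
        ≤ |-(plaq θ (site y q) ν.1 μ) + θ (site y q) ν.1| + |θ (site y q + e μ) ν.1| := abs_sub _ _
      _ ≤ (|-(plaq θ (site y q) ν.1 μ)| + |θ (site y q) ν.1|) + |θ (site y q + e μ) ν.1| := by
          gcongr; exact abs_add_le _ _
      _ ≤ (Pb + I) + I := by rw [abs_neg]; gcongr
      _ = Pb + 2 * I := by ring
  obtain ⟨ν, hu, hν | hν⟩ := hadj
  · exact key t u ν hu hν
  · rw [abs_sub_comm]
    exact key u t ν (fun κ hκ => (hu κ hκ).symm) hν

/-- [folklore] ℓ¹ distance of two transverse positions. -/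
def dist1 {L : ℕ} {μ : Fin d} (t u : Trans d L μ) : ℕ := ∑ ν, (((t ν : ℕ) - u ν) + ((u ν : ℕ) - t ν))

/-- [cite: Balaban1985RegularSpaces, Lemma 1 proof p.79] "… for an arbitrary bond b ∈ B(c)": any two crossing
bonds are joined by a chain of `dist1 t u` transverse steps. -/
theorem reach_of_dist1 {L : ℕ} {μ : Fin d} (u : Trans d L μ) :
    ∀ n (t : Trans d L μ), dist1 t u = n → B8Lemma1Abelian.Reach StepAdj n t u := by
  intro n
  induction n with
  | zero =>
    intro t ht
    have htu : t = u := by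
      funext ν
      have h0 := (Finset.sum_eq_zero_iff.1 ht) ν (Finset.mem_univ ν)
      exact Fin.ext (by omega)
    subst htu
    exact B8Lemma1Abelian.Reach.refl _
  | succ n ih =>
    intro t ht
    have hne : ∃ ν, (t ν : ℕ) ≠ u ν := by
      by_contra hall
      push Not at hall
      have : dist1 t u = 0 := Finset.sum_eq_zero (fun ν _ => by rw [hall ν]; simp)
      omega
    obtain ⟨ν, hν⟩ := hne
    have hsplit : ∀ w : Trans d L μ, dist1 w u
        = (((w ν : ℕ) - u ν) + ((u ν : ℕ) - w ν)) + ∑ κ ∈ univ.erase ν, (((w κ : ℕ) - u κ) + ((u κ : ℕ) - w κ)) := by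
      intro w; unfold dist1; rw [← Finset.add_sum_erase _ _ (Finset.mem_univ ν)]
    rcases lt_or_gt_of_ne hν with hlt | hgt
    · let t₁ : Trans d L μ := Function.update t ν ⟨t ν + 1, by have := (u ν).isLt; omega⟩
      have ht₁ν : (t₁ ν : ℕ) = t ν + 1 := by simp [t₁]
      have ht₁ne : ∀ κ, κ ≠ ν → t₁ κ = t κ := fun κ hκ => by simp [t₁, hκ]
      have hadj : StepAdj t t₁ := ⟨ν, ht₁ne, Or.inl ht₁ν⟩
      have hd : dist1 t₁ u = n := by
        have h1 := hsplit t
        have h2 := hsplit t₁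
        have hrest : ∑ κ ∈ univ.erase ν, (((t₁ κ : ℕ) - u κ) + ((u κ : ℕ) - t₁ κ))
            = ∑ κ ∈ univ.erase ν, (((t κ : ℕ) - u κ) + ((u κ : ℕ) - t κ)) := by
          apply Finset.sum_congr rfl; intro κ hκ; rw [ht₁ne κ (Finset.ne_of_mem_erase hκ)]
        rw [hrest, ht₁ν] at h2
        omega
      exact B8Lemma1Abelian.Reach.step hadj (ih t₁ hd)
    · let t₁ : Trans d L μ := Function.update t ν ⟨t ν - 1, by have := (t ν).isLt; omega⟩
      have ht₁ν : (t₁ ν : ℕ) = t ν - 1 := by simp [t₁]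
      have ht₁ne : ∀ κ, κ ≠ ν → t₁ κ = t κ := fun κ hκ => by simp [t₁, hκ]
      have hadj : StepAdj t t₁ := ⟨ν, ht₁ne, Or.inr (by rw [ht₁ν]; omega)⟩
      have hd : dist1 t₁ u = n := by
        have h1 := hsplit t
        have h2 := hsplit t₁
        have hrest : ∑ κ ∈ univ.erase ν, (((t₁ κ : ℕ) - u κ) + ((u κ : ℕ) - t₁ κ))
            = ∑ κ ∈ univ.erase ν, (((t κ : ℕ) - u κ) + ((u κ : ℕ) - t κ)) := by
          apply Finset.sum_congr rfl; intro κ hκ; rw [ht₁ne κ (Finset.ne_of_mem_erase hκ)]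
        rw [hrest, ht₁ν] at h2
        omega
      exact B8Lemma1Abelian.Reach.step hadj (ih t₁ hd)

/-- [cite: Balaban1985RegularSpaces, Lemma 1 proof p.79] "… < (d−1)(L−1)·4dα₀L⁻¹": at most `(d−1)(L−1)`
transverse steps join any two crossing bonds of `B(c)`. -/
theorem dist1_le {L : ℕ} {μ : Fin d} (t u : Trans d L μ) : dist1 t u ≤ (d - 1) * (L - 1) := by
  unfold dist1
  have hle : ∀ ν ∈ (univ : Finset {ν : Fin d // ν ≠ μ}), (((t ν : ℕ) - u ν) + ((u ν : ℕ) - t ν)) ≤ L - 1 := by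
    intro ν _; have := (t ν).isLt; have := (u ν).isLt; omega
  have h := Finset.sum_le_card_nsmul _ _ _ hle
  have hcard : (univ : Finset {ν : Fin d // ν ≠ μ}).card = d - 1 := by
    rw [Finset.card_univ, Fintype.card_subtype_compl, Fintype.card_fin, Fintype.card_subtype_eq]
  rw [hcard, smul_eq_mul] at h
  exact h


/-! ### §4 Lemma 1 on the lattice carriers -/

/-- [cite: Balaban1985RegularSpaces, (1.7) p.77 with k = 1, j = 1] `small α₀ V₀ V′`: the hypothesis
"V₀, V′V₀ satisfy the condition (1.7) for k = 1" — `|U(∂p) − 1| < α₀L^{−2}` for the plaquettes `p ⊂ Ω₁` — in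
the additive model, for BOTH `V₀ = θ₀` and `V′V₀ = θ₀ + θ′`, on the plaquettes of `B(c₋) ∪ B(c₊)` (the only
ones the proof uses, locality remark p. 80). -/
def Small (L : ℕ) (y : Site d) (μ : Fin d) (α₀ : ℝ) (θ₀ θ' : Config d) : Prop :=
  ∀ x : Site d, ∀ ρ ν : Fin d, ρ ≠ ν → InPair L y μ x → InPair L y μ (x + e ρ) → InPair L y μ (x + e ν) →
    InPair L y μ (x + e ρ + e ν) →
      |plaq θ₀ x ρ ν| < α₀ / (L : ℝ) ^ 2 ∧ |plaq (θ₀ + θ') x ρ ν| < α₀ / (L : ℝ) ^ 2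

/-- [cite: Balaban1985RegularSpaces, (1.24) p.79] `axialClose α₁ V₀ V′` = (1.24): the axial gauge
`(R(V₀)V′)(Γ_{y,x}) = 1, x ∈ B(y)` in both blocks `y = c₋, c₊`, and `|(V′V₀)‾ − V̄₀| < α₁` at the bond `c`,
the averages being (42) of [Balaban1985Averaging] in the additive model. -/
def AxialClose (L : ℕ) (y : Site d) (μ : Fin d) (α₁ : ℝ) (θ₀ θ' : Config d) : Prop :=
  TreeGauge L θ' y ∧ TreeGauge L θ' (yplus L y μ) ∧ |avg L y μ (θ₀ + θ') - avg L y μ θ₀| < α₁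

/-- [folklore] The sites of `B(z)` as a `Finset`. -/
noncomputable def blockSites (L : ℕ) (z : Site d) : Finset (Site d) := Fintype.piFinset fun κ => Finset.Ico (z κ) (z κ + L)

/-- [folklore] Membership in `blockSites` is `InBlock`. -/
theorem mem_blockSites {L : ℕ} {z x : Site d} : x ∈ blockSites L z ↔ InBlock L z x := by
  simp [blockSites, InBlock, Fintype.mem_piFinset, Finset.mem_Ico]

/-- [folklore] The sites of `B(c₋) ∪ B(c₊)`. -/
noncomputable def pairSites (L : ℕ) (y : Site d) (μ : Fin d) : Finset (Site d) := blockSites L y ∪ blockSites L (yplus L y μ)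

/-- [folklore] Membership in `pairSites` is `InPair`. -/
theorem mem_pairSites {L : ℕ} {y : Site d} {μ : Fin d} {x : Site d} : x ∈ pairSites L y μ ↔ InPair L y μ x := by
  simp [pairSites, InPair, mem_blockSites]

/-- [cite: Balaban1985RegularSpaces, (1.25) p.79 and p.80 l.3–5] The bonds `b` with both ends in `B(c₋) ∪ B(c₊)`
(the bonds for which (1.25) is concluded from the data at `c`). -/
noncomputable def regionBonds (L : ℕ) (y : Site d) (μ : Fin d) : Finset (Site d × Fin d) :=
  ((pairSites L y μ) ×ˢ (univ : Finset (Fin d))).filter (fun b => b.1 + e b.2 ∈ pairSites L y μ)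

/-- [cite: Balaban1985RegularSpaces, (1.25) p.79] `pertDev V′ = sup_b |V′_b − 1|` over the bonds of
`B(c₋) ∪ B(c₊)` in the additive model (`0` for an empty region). -/
noncomputable def pertDev (L : ℕ) (y : Site d) (μ : Fin d) (θ' : Config d) : ℝ :=
  if h : (regionBonds L y μ).Nonempty then (regionBonds L y μ).sup' h (fun b => |θ' b.1 b.2|) else 0

/-- [folklore] A strict bondwise bound on the region bounds `pertDev` strictly (for a positive bound). -/
theorem pertDev_lt {L : ℕ} {y : Site d} {μ : Fin d} {θ' : Config d} {B : ℝ} (hB : 0 < B)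
    (h : ∀ x ν, InPair L y μ x → InPair L y μ (x + e ν) → |θ' x ν| < B) : pertDev L y μ θ' < B := by
  unfold pertDev
  split_ifs with hne
  · rw [Finset.sup'_lt_iff]
    intro b hb
    simp only [regionBonds, Finset.mem_filter, Finset.mem_product, Finset.mem_univ, and_true,
      mem_pairSites] at hb
    exact h b.1 b.2 hb.1 hb.2
  · exact hB

/-- [folklore] A site of `B(c₊)` has no lattice neighbour `x + e_ν` … rather: if `x ∈ B(c₊)` and
`x + e_ν ∈ B(c₋)` we get a contradiction (the `μ`-coordinates are `≥ y_μ + L` resp. `< y_μ + L`, and a unit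
step does not decrease a coordinate). -/
theorem not_right_left {L : ℕ} {y : Site d} {μ : Fin d} {x : Site d} {ν : Fin d}
    (hx : InBlock L (yplus L y μ) x) (hx' : InBlock L y (x + e ν)) : False := by
  have h1 := (hx μ).1
  have h2 := (hx' μ).2
  simp only [yplus, site, Pi.single_eq_same, Pi.add_apply, e] at h1 h2
  by_cases hνμ : ν = μ
  · subst hνμ; simp at h2; omega
  · rw [Pi.single_eq_of_ne (Ne.symm hνμ)] at h2
    -- careful: `Pi.single ν 1 μ = 0` since μ ≠ ν
    omega

/-- [cite: Balaban1985RegularSpaces, Lemma 1 pp.79–80] **Lemma 1 on the lattice** (additive model): under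
(1.7) for `k = 1` on `B(c₋) ∪ B(c₊)` and (1.24), every bond `b` of `B(c₋) ∪ B(c₊)` satisfies
`|θ′_b| < 4d²α₀ + α₁` — (1.25).  Interior and tree bonds by `interior_bound` / `treeBond_eq_zero`
(`≤ (d−1)(L−1)·2α₀L⁻²`), crossing bonds by `B8Lemma1Abelian.lemma1_abelian`, whose geometric hypotheses
(`N = (d−1)(L−1)` steps, step size `s`, `L − 1` interior bonds of size `≤ I` per contour, the mean) are
discharged here by `dist1_le` / `reach_of_dist1`, `crossVal_step`, `abs_interiorPart_le`, `avg_add_sub`. -/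
theorem lemma1_lattice {L : ℕ} (hL : 1 ≤ L) (y : Site d) (μ : Fin d) {α₀ α₁ : ℝ} (hα₀ : 0 < α₀)
    (θ₀ θ' : Config d) (hS : Small L y μ α₀ θ₀ θ') (hA : AxialClose L y μ α₁ θ₀ θ') :
    ∀ x ν, InPair L y μ x → InPair L y μ (x + e ν) → |θ' x ν| < 4 * (d : ℝ) ^ 2 * α₀ + α₁ := by
  obtain ⟨hTy, hTy', hmean⟩ := hA
  have hd : 1 ≤ d := by have := μ.isLt; omega
  have hLpos : 0 < L := hL
  have hLr : (1 : ℝ) ≤ L := by exact_mod_cast hL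
  have hdr : (1 : ℝ) ≤ d := by exact_mod_cast hd
  -- (1.26): the perturbation's plaquettes are bounded by `P = 2α₀L⁻²`
  have hP : PlaqBoundPair L y μ θ' (B8Lemma1Abelian.P α₀ L) := by
    intro x ρ ν hρν h1 h2 h3 h4
    obtain ⟨ha, hb⟩ := hS x ρ ν hρν h1 h2 h3 h4
    have hsplit : plaq θ' x ρ ν = plaq (θ₀ + θ') x ρ ν - plaq θ₀ x ρ ν := by rw [plaq_add]; ring
    rw [hsplit, B8Lemma1Abelian.P]
    calc |plaq (θ₀ + θ') x ρ ν - plaq θ₀ x ρ ν| ≤ |plaq (θ₀ + θ') x ρ ν| + |plaq θ₀ x ρ ν| := abs_sub _ _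
      _ ≤ α₀ / (L : ℝ) ^ 2 + α₀ / (L : ℝ) ^ 2 := by linarith
      _ = 2 * α₀ / (L : ℝ) ^ 2 := by ring
  have hPb : 0 ≤ B8Lemma1Abelian.P α₀ L := by unfold B8Lemma1Abelian.P; positivity
  have hIdef : ((d : ℝ) - 1) * ((L : ℝ) - 1) * B8Lemma1Abelian.P α₀ L = B8Lemma1Abelian.I d L α₀ := rfl
  -- the interior bound is below the printed one
  have hI_lt : B8Lemma1Abelian.I d L α₀ < 4 * (d : ℝ) ^ 2 * α₀ + α₁ := by
    have hα₁ : 0 < α₁ := lt_of_le_of_lt (abs_nonneg _) hmean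
    unfold B8Lemma1Abelian.I B8Lemma1Abelian.P
    have hL2 : (0 : ℝ) < (L : ℝ) ^ 2 := by positivity
    have hLsq : (L : ℝ) - 1 ≤ (L : ℝ) ^ 2 := by nlinarith [hLr]
    have h1 : ((L : ℝ) - 1) * (2 * α₀ / (L : ℝ) ^ 2) ≤ 2 * α₀ := by
      rw [← mul_div_assoc, div_le_iff₀ hL2]
      have := mul_le_mul_of_nonneg_right hLsq (by positivity : (0 : ℝ) ≤ 2 * α₀)
      linarith
    have h2 : ((d : ℝ) - 1) * 2 ≤ 4 * (d : ℝ) ^ 2 := by nlinarith [hdr]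
    have h3 := mul_le_mul_of_nonneg_right h2 hα₀.le
    calc ((d : ℝ) - 1) * ((L : ℝ) - 1) * (2 * α₀ / (L : ℝ) ^ 2)
        = ((d : ℝ) - 1) * (((L : ℝ) - 1) * (2 * α₀ / (L : ℝ) ^ 2)) := by ring
      _ ≤ ((d : ℝ) - 1) * (2 * α₀) := by apply mul_le_mul_of_nonneg_left h1; linarith
      _ = ((d : ℝ) - 1) * 2 * α₀ := by ring
      _ < 4 * (d : ℝ) ^ 2 * α₀ + α₁ := by linarith
  -- the crossing bonds: instantiate the abelian-model Lemma 1
  have hcross : ∀ t : Trans d L μ, |crossVal L y μ θ' t| < 4 * (d : ℝ) ^ 2 * α₀ + α₁ := by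
    intro t
    haveI : Nonempty (Fin L) := ⟨⟨0, hLpos⟩⟩
    have hn : (((d - 1) * (L - 1) : ℕ) : ℝ) = B8Lemma1Abelian.N d L := by
      rw [B8Lemma1Abelian.N, Nat.cast_mul, Nat.cast_sub hd, Nat.cast_sub hL, Nat.cast_one]
    refine B8Lemma1Abelian.lemma1_abelian hLpos hd (crossVal L y μ θ')
      (fun t h => interiorPart L y μ θ' t h) hα₀ StepAdj hn ?_ ?_ ?_ ?_ t
    · -- `L − 1` interior bonds of size `≤ I` per contour
      intro t h
      rw [← hIdef]
      exact abs_interiorPart_le hTy hTy' hP hPb t h.isLt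
    · -- the mean: (1.24) ⇒ `|avg θ′| < α₁`, and `avg θ′` is the mean of `crossVal + interiorPart`
      have havg : avg L y μ θ' = (∑ t : Trans d L μ, ∑ h : Fin L,
          (crossVal L y μ θ' t + interiorPart L y μ θ' t h)) / ((Fintype.card (Trans d L μ) : ℝ) * L) := by
        unfold avg
        congr 1
        apply Finset.sum_congr rfl; intro t _
        apply Finset.sum_congr rfl; intro h _
        rw [contourSum_eq_segment hTy hTy' t h.isLt, segment_split y μ θ' t h.isLt]
      rw [← havg, ← avg_add_sub L y μ θ₀ θ']
      exact hmean
    · -- neighbouring crossing bonds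
      intro t u hadj
      have := crossVal_step hTy hTy' hP hPb hL hadj
      simpa [B8Lemma1Abelian.s, hIdef] using this
    · -- any two crossing bonds are `≤ (d−1)(L−1)` steps apart
      intro t u
      exact ⟨dist1 t u, dist1_le t u, reach_of_dist1 u _ t rfl⟩
  -- case analysis over the bonds of `B(c₋) ∪ B(c₊)`
  intro x ν hx hxν
  have interior_y : ∀ {z : Site d}, TreeGauge L θ' z → PlaqBound L θ' z (B8Lemma1Abelian.P α₀ L) →
      InBlock L z x → InBlock L z (x + e ν) → |θ' x ν| < 4 * (d : ℝ) ^ 2 * α₀ + α₁ := by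
    intro z hT hPz h1 h2
    obtain ⟨k, hk, rfl⟩ := exists_offset_of_inBlock h1
    have hν : k ν + 1 < L := by
      have := (h2 ν).2
      simp only [site, e, Pi.add_apply, Pi.single_eq_same] at this
      omega
    exact lt_of_le_of_lt (hIdef ▸ interior_bound hT hPz hPb k hk ν hν) hI_lt
  rcases hxν with hxν | hxν
  · -- `x + e_ν ∈ B(c₋)`: then `x ∈ B(c₋)` as well
    rcases hx with hx | hx
    · exact interior_y hTy (plaqBound_left hP) hx hxν
    · exact (not_right_left hx hxν).elim
  · rcases hx with hx | hx
    · -- `x ∈ B(c₋)`, `x + e_ν ∈ B(c₊)`: a crossing bond, `ν = μ`, `x_μ = y_μ + L − 1`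
      obtain ⟨k, hk, rfl⟩ := exists_offset_of_inBlock hx
      have hνμ : ν = μ := by
        by_contra hνμ
        have h1 := (hxν μ).1
        simp only [yplus, site, e, Pi.add_apply, Pi.single_eq_same, Pi.single_eq_of_ne (Ne.symm hνμ) ] at h1
        have := hk μ
        omega
      subst hνμ
      have hkν : k ν = L - 1 := by
        have h1 := (hxν ν).1
        simp only [yplus, site, e, Pi.add_apply, Pi.single_eq_same] at h1
        have := hk ν
        omega
      -- the transverse position
      set t : Trans d L ν := fun κ => ⟨k κ.1, hk κ.1⟩ with ht
      have hkt : k = offset ν t (L - 1) := by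
        funext κ
        by_cases hκ : κ = ν
        · subst hκ; rw [offset_apply_mu, hkν]
        · rw [offset_apply_ne ν t _ hκ]
      have := hcross t
      rwa [crossVal, ← hkt] at this
    · -- both ends in `B(c₊)`
      by_cases hxν' : InBlock L y (x + e ν)
      · exact (not_right_left hx hxν').elim
      · exact interior_y hTy' (plaqBound_right hP) hx hxν

/-- [cite: Balaban1985RegularSpaces, Lemma 1 p.79; (1.23)] **The concrete Lemma-1 carriers**: one
`B8.LocalData` per coarse bond `c = ⟨y, y + L e_μ⟩` of a corner lattice (`y` = the corner of `B(c₋)`,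
cf. [Balaban1985Averaging] p. 24), with configurations / perturbations = additive bond fields on `ℤ^d`,
`small` = (1.7) for `k = 1` on `B(c₋) ∪ B(c₊)`, `axialClose` = (1.24), `pertDev` = `sup_b |V′_b − 1|` there. -/
noncomputable def blockPair (d L : ℕ) (c : Site d × Fin d) : B8.LocalData where
  Cfg := Config d
  Pert := Config d
  small := fun α₀ θ₀ θ' => Small L c.1 c.2 α₀ θ₀ θ'
  axialClose := fun α₁ θ₀ θ' => AxialClose L c.1 c.2 α₁ θ₀ θ'
  pertDev := fun θ' => pertDev L c.1 c.2 θ'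

/-- [cite: Balaban1985RegularSpaces, Lemma 1 pp.79–80] **`B8.Lemma1Printed` holds for the lattice carriers**
(the DAG leaf `DagBinding.B8LeafR.l1` on a concrete family, hypothesis-free: for `L = 0` the region is empty,
for `d = 0` there is no bond direction). The constant `c(α₀, α₁)` of the lemma is irrelevant here (`c = 1`). -/
theorem lemma1Printed_blockPair (d L : ℕ) : B8.Lemma1Printed d (blockPair d L) := by
  refine ⟨1, one_pos, ?_⟩
  rintro ⟨y, μ⟩ α₀ α₁ hα₀ - hα₁ - θ₀ θ' hS hA
  change pertDev L y μ θ' < 4 * (d : ℝ) ^ 2 * α₀ + α₁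
  have hbound : 0 < 4 * (d : ℝ) ^ 2 * α₀ + α₁ := by positivity
  rcases Nat.eq_zero_or_pos L with hL0 | hLpos
  · subst hL0
    refine pertDev_lt hbound ?_
    intro x ν hx _
    exfalso
    rcases hx with hx | hx
    · have := hx μ; omega
    · have := hx μ; omega
  · exact pertDev_lt hbound (lemma1_lattice hLpos y μ hα₀ θ₀ θ' hS hA)

end Literature.MathematicalPhysics.QuantumFieldTheory.Balaban1983to89.B8Lemma1Lattice
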